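import Literature.Probability.RandomPlanarGeometry.ExcursionRestrictionHarmonic
import Literature.Probability.RandomPlanarGeometry.ChordalPathFill
import Literature.Probability.Process.NewtonPotential
import HarnessLib

/-!
# Inputs for the excursion route to `P_1`: the excursion path is chordal, and the assembly from a four-dimensional process

Proof-only companion (no definition, no named fact) of `ExcursionRestrictionHarmonic` and
`ChordalPathFill`, after

* G. F. Lawler, O. Schramm, W. Werner, *Conformal restriction: the chordal case*, J. Amer.
  Math. Soc. **16** (2003) 917–955, arXiv:math/0209343 (**[LSW]**), §4 p. 16: "a
  three-dimensional Bessel process is the modulus (Euclidean norm) of a three-dimensional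
  Brownian motion […] Note that almost surely `lim_{t→∞} Y_t = ∞`. The Brownian excursion can be
  defined as `B_t = X_t + iY_t`. […] `B(0, ∞) ⊂ ℍ` almost surely"; Prop. 4.1: "For all
  `A ∈ 𝒬*`, `P[B[0, ∞) ∩ A = ∅] = Φ_A'(0)`"; and the sentence after its proof: "We have just
  proved that the two-sided restriction measure `P_1` exists".

For the four-dimensional Brownian motion `W = (W⁰, W⃗)` of the tree's route to [LSW] Prop. 4.1
(`ExcursionRestrictionHarmonic`: the excursion is `Z = W⁰ + i|W⃗|`, i.e. `Z_t = exPt (W_t)`;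
`Process/NewtonPotential`, `Process/BrownianVecHarmonic`: the radial harmonic function
`Process.newton = |w|⁻¹` and the stopped harmonic identity, for "`B(0, ∞) ⊂ ℍ`" and
"`lim Y_t = ∞`"):

1. `Process.spRad_eq_exRad`, `mem_offAxis_iff_exRad_ne_zero`, `exDom_eq_offAxis_inter` — the
   spatial radius `Process.spRad` of `NewtonPotential` IS `exRad` (definitionally), and
   `D_A = offAxis ∩ exPt⁻¹(Aᶜ)`: the two coordinate systems on `ℝ⁴ = Fin 4 → ℝ` agree;
2. `isChordalPath_exPt_comp` — **the excursion path of a continuous `ℝ⁴`-valued path started at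
   `0` whose spatial radius is positive at positive times and tends to `∞` is a chordal path**
   (`IsChordalPath` of `ChordalPathFill`: continuous, `0` at `0`, in `ℍ` at positive times,
   `|Z_t| → ∞`), and `disjoint_range_exPt_iff` (avoiding `A` is `∀ t, exPt (W_t) ∉ A`);
3. `exists_isRestrictionMeasure_one_of_excursionProcess` — **THE ASSEMBLY: `P_1` exists as soon
   as some probability space carries a process `W : ℝ≥0 → Ω → ℝ⁴` with measurable marginals and
   continuous paths from `0` such that, almost surely, `|W⃗_t| ≠ 0` for `t > 0` and
   `|W⃗_t| → ∞`, and `ℙ[∀ t, exPt (W_t) ∉ A] = Φ'_A(0)` for every `A ∈ 𝒬*`** (the law of the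
   filling of `Z`, `exists_isRestrictionMeasure_of_chordalPath`); with the consequences already
   in the tree: p. 5 result 2 in both readings and `LawlerSchrammWerner2003`
   (`…_of_excursionProcess`). What such a process must still be shown to satisfy is thus
   exactly: the two sample-path facts and the avoidance identity of Prop. 4.1, for which
   `ExcursionRestrictionHarmonic` supplies the harmonic function `U` with its boundary values.

## References

* [LSW] §4 p. 16, Prop. 4.1. [LawlerSchrammWerner2003Restriction]
-/

noncomputable section

open Set Filter Metric Function MeasureTheory
open _root_.Topology
open UpperHalfPlane (upperHalfPlaneSet)
open Literature.Probability.Process (bvec hess lap)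
open scoped NNReal ENNReal

namespace Literature.Probability.RandomPlanarGeometry

/-! ### The two coordinate systems on `ℝ⁴` agree -/

/-- `Process.spSq = exSq` (both are `v₁² + v₂² + v₃²`). [folklore] -/
theorem _root_.Literature.Probability.Process.spSq_eq_exSq :
    Literature.Probability.Process.spSq = exSq := rfl

/-- **`Process.spRad = exRad`**: the spatial radius of `NewtonPotential` is the `|w|` of
`ExcursionRestrictionHarmonic`. [folklore] -/
theorem _root_.Literature.Probability.Process.spRad_eq_exRad :
    Literature.Probability.Process.spRad = exRad := rfl

/-- Off the axis iff `|w| ≠ 0`. [folklore] -/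
theorem mem_offAxis_iff_exRad_ne_zero {v : Fin 4 → ℝ} :
    v ∈ Literature.Probability.Process.offAxis ↔ exRad v ≠ 0 :=
  exRad_ne_zero_iff.symm

/-- `D_A = offAxis ∩ exPt⁻¹(Aᶜ)`. [folklore] -/
theorem exDom_eq_offAxis_inter (A : Set ℂ) :
    exDom A = Literature.Probability.Process.offAxis ∩ exPt ⁻¹' Aᶜ := by
  ext v
  simp only [exDom, mem_setOf_eq, mem_inter_iff, mem_offAxis_iff_exRad_ne_zero, mem_preimage,
    mem_compl_iff]

/-! ### The excursion path of an `ℝ⁴`-valued path -/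

section Path

variable {W : ℝ≥0 → (Fin 4 → ℝ)}

/-- `‖exPt q‖ ≥ |w|`. [folklore] -/
theorem exRad_le_norm_exPt (q : Fin 4 → ℝ) : exRad q ≤ ‖exPt q‖ := by
  have h := Complex.im_le_norm (exPt q)
  rwa [exPt_im] at h

/-- `exPt 0 = 0`. [folklore] -/
@[simp] theorem exPt_zero : exPt 0 = 0 := Complex.ext (by simp) (by simp [exRad])

/-- **The excursion path is a chordal path**: for a continuous `W : [0, ∞) → ℝ⁴` with `W_0 = 0`,
`|w(W_t)| ≠ 0` for `t > 0` and `|w(W_t)| → ∞`, the path `t ↦ exPt (W_t) = x(W_t) + i|w(W_t)|`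
is continuous, starts at `0`, lies in `ℍ` at positive times and tends to `∞` — [LSW]'s
"`B(0, ∞) ⊂ ℍ` almost surely" and "`lim Y_t = ∞`" turned into the deterministic shape
`IsChordalPath` of `ChordalPathFill`. [cite: LawlerSchrammWerner2003Restriction, §4 p. 16] -/
theorem isChordalPath_exPt_comp (hc : Continuous W) (h0 : W 0 = 0)
    (hpos : ∀ t : ℝ≥0, 0 < t → exRad (W t) ≠ 0)
    (hinf : Tendsto (fun t ↦ exRad (W t)) atTop atTop) :
    IsChordalPath fun t ↦ exPt (W t) := by
  refine ⟨continuous_exPt.comp hc, fun t ht ↦ ?_, by simp [h0], ?_⟩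
  · rw [exPt_im]
    exact exRad_pos (hpos t ht)
  · exact tendsto_atTop_mono (fun t ↦ exRad_le_norm_exPt (W t)) hinf

/-- Avoiding `A` along the excursion path is `∀ t, exPt (W_t) ∉ A`. [folklore] -/
theorem disjoint_range_exPt_iff {A : Set ℂ} :
    Disjoint (range fun t ↦ exPt (W t)) A ↔ ∀ t, exPt (W t) ∉ A := by
  rw [Set.disjoint_left]
  exact ⟨fun h t ht ↦ h (mem_range_self t) ht, fun h z ⟨t, ht⟩ hz ↦ h t (by simpa only [← ht] using hz)⟩

/-- At a positive time with `|w| ≠ 0`, "`exPt (W_t) ∉ A`" is "`W_t ∈ D_A`". [folklore] -/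
theorem mem_exDom_iff_of_ne {A : Set ℂ} {q : Fin 4 → ℝ} (hq : exRad q ≠ 0) :
    q ∈ exDom A ↔ exPt q ∉ A :=
  ⟨fun h ↦ h.2, fun h ↦ ⟨hq, h⟩⟩

end Path

/-! ### The assembly: `P_1` from a four-dimensional process with the excursion properties -/

section Assembly

variable {Ω : Type*} [MeasurableSpace Ω] {ℙ : Measure Ω} [IsProbabilityMeasure ℙ]
  {W : ℝ≥0 → Ω → (Fin 4 → ℝ)}

/-- **`P_1` exists, given a process with the excursion properties.** Let `W : [0, ∞) × Ω → ℝ⁴`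
have measurable marginals and continuous paths with `W_0 = 0`, and suppose that almost surely
`|w(W_t)| ≠ 0` for all `t > 0` and `|w(W_t)| → ∞`, and that for every `A ∈ 𝒬*` (restriction
map `Φ`, `d = Φ'_A(0)`) `ℙ[∀ t, exPt (W_t) ∉ A] = d`. Then the law of the filling of the path
`t ↦ exPt (W_t)` is a two-sided restriction measure of exponent `1`; in particular `P_1`
exists ([LSW]: "We have just proved that the two-sided restriction measure `P_1` exists").
For the four-dimensional Brownian motion the three hypotheses are [LSW]'s "`B(0, ∞) ⊂ ℍ`",
"`lim Y_t = ∞`" and Prop. 4.1.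
[cite: LawlerSchrammWerner2003Restriction, §4 Prop. 4.1 (p. 16) and the sentence following its proof] -/
theorem exists_isRestrictionMeasure_one_of_excursionProcess
    (hmeas : ∀ t, Measurable (W t)) (hcont : ∀ ω, Continuous (W · ω)) (h0 : ∀ ω, W 0 ω = 0)
    (hpolar : ∀ᵐ ω ∂ℙ, ∀ t : ℝ≥0, 0 < t → exRad (W t ω) ≠ 0)
    (htrans : ∀ᵐ ω ∂ℙ, Tendsto (fun t ↦ exRad (W t ω)) atTop atTop)
    (havoid : ∀ {A : Set ℂ}, IsStarHull A →
      ∀ {Φ : ConformalEquiv (upperHalfPlaneSet \ A) upperHalfPlaneSet}, IsRestrictionMap A Φ →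
        ∀ {d : ℝ}, HasRestrictionDeriv A Φ d →
          ℙ {ω | ∀ t, exPt (W t ω) ∉ A} = ENNReal.ofReal d) :
    ∃ P : Measure RestrictionConfig, IsRestrictionMeasure 1 P := by
  have hpath : ∀ᵐ ω ∂ℙ, IsChordalPath fun t ↦ exPt (W t ω) := by
    filter_upwards [hpolar, htrans] with ω h1 h2
    exact isChordalPath_exPt_comp (hcont ω) (h0 ω) h1 h2
  have hmk : ∀ q : ℚ, AEMeasurable (fun ω ↦ exPt (W (Real.toNNReal q) ω)) ℙ := fun q ↦
    (continuous_exPt.measurable.comp (hmeas _)).aemeasurable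
  refine exists_isRestrictionMeasure_of_chordalPath (B := fun ω t ↦ exPt (W t ω)) hpath hmk (α := 1)
    fun hA _ hΦ _ hd ↦ ?_
  rw [Real.rpow_one, ← havoid hA hΦ hd]
  congr 1
  ext ω
  exact disjoint_range_exPt_iff

/-- **[LSW] p. 5 result 2 (almost-everywhere reading), given a process with the excursion
properties** (`IsRestrictionMeasure.eq_five_eighths_of_simple_of_exists_one`).
[cite: LawlerSchrammWerner2003Restriction, p. 5 result 2 with Prop. 4.1 (p. 16)] -/
theorem IsRestrictionMeasure.eq_five_eighths_of_simple_of_excursionProcess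
    (hmeas : ∀ t, Measurable (W t)) (hcont : ∀ ω, Continuous (W · ω)) (h0 : ∀ ω, W 0 ω = 0)
    (hpolar : ∀ᵐ ω ∂ℙ, ∀ t : ℝ≥0, 0 < t → exRad (W t ω) ≠ 0)
    (htrans : ∀ᵐ ω ∂ℙ, Tendsto (fun t ↦ exRad (W t ω)) atTop atTop)
    (havoid : ∀ {A : Set ℂ}, IsStarHull A →
      ∀ {Φ : ConformalEquiv (upperHalfPlaneSet \ A) upperHalfPlaneSet}, IsRestrictionMap A Φ →
        ∀ {d : ℝ}, HasRestrictionDeriv A Φ d →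
          ℙ {ω | ∀ t, exPt (W t ω) ∉ A} = ENNReal.ofReal d) :
    IsRestrictionMeasure.eq_five_eighths_of_simple :=
  IsRestrictionMeasure.eq_five_eighths_of_simple_of_exists_one
    (exists_isRestrictionMeasure_one_of_excursionProcess hmeas hcont h0 hpolar htrans havoid)

/-- **[LSW] p. 5 result 2 (outer reading), given a process with the excursion properties.**
[cite: LawlerSchrammWerner2003Restriction, p. 5 result 2 with Prop. 4.1 (p. 16)] -/
theorem IsRestrictionMeasure.eq_five_eighths_of_outer_simple_of_excursionProcess
    (hmeas : ∀ t, Measurable (W t)) (hcont : ∀ ω, Continuous (W · ω)) (h0 : ∀ ω, W 0 ω = 0)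
    (hpolar : ∀ᵐ ω ∂ℙ, ∀ t : ℝ≥0, 0 < t → exRad (W t ω) ≠ 0)
    (htrans : ∀ᵐ ω ∂ℙ, Tendsto (fun t ↦ exRad (W t ω)) atTop atTop)
    (havoid : ∀ {A : Set ℂ}, IsStarHull A →
      ∀ {Φ : ConformalEquiv (upperHalfPlaneSet \ A) upperHalfPlaneSet}, IsRestrictionMap A Φ →
        ∀ {d : ℝ}, HasRestrictionDeriv A Φ d →
          ℙ {ω | ∀ t, exPt (W t ω) ∉ A} = ENNReal.ofReal d) :
    IsRestrictionMeasure.eq_five_eighths_of_outer_simple :=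
  IsRestrictionMeasure.eq_five_eighths_of_outer_simple_of_exists_one
    (exists_isRestrictionMeasure_one_of_excursionProcess hmeas hcont h0 hpolar htrans havoid)

/-- **`LawlerSchrammWerner2003` (chordal restriction + simple curves ⇒ SLE_{8/3}), given a
process with the excursion properties.** [cite: LawlerSchrammWerner2003Restriction, p. 5 result 2 with Prop. 4.1 (p. 16)] -/
theorem LawlerSchrammWerner2003_of_excursionProcess
    (hmeas : ∀ t, Measurable (W t)) (hcont : ∀ ω, Continuous (W · ω)) (h0 : ∀ ω, W 0 ω = 0)
    (hpolar : ∀ᵐ ω ∂ℙ, ∀ t : ℝ≥0, 0 < t → exRad (W t ω) ≠ 0)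
    (htrans : ∀ᵐ ω ∂ℙ, Tendsto (fun t ↦ exRad (W t ω)) atTop atTop)
    (havoid : ∀ {A : Set ℂ}, IsStarHull A →
      ∀ {Φ : ConformalEquiv (upperHalfPlaneSet \ A) upperHalfPlaneSet}, IsRestrictionMap A Φ →
        ∀ {d : ℝ}, HasRestrictionDeriv A Φ d →
          ℙ {ω | ∀ t, exPt (W t ω) ∉ A} = ENNReal.ofReal d) :
    LawlerSchrammWerner2003 :=
  LawlerSchrammWerner2003_of_exists_one
    (exists_isRestrictionMeasure_one_of_excursionProcess hmeas hcont h0 hpolar htrans havoid)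

end Assembly

end Literature.Probability.RandomPlanarGeometry

end
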